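import Summits.CriticalPhenomena.Ising3DConformalLimit.Theses.InverseSquareTelemetry
import Literature.Probability.LatticeModels.CriticalTwoPointLawDimension

/-!
# CriticalPhenomena / Ising3DConformalLimit — route `InverseSquareTelemetry`, glue `PowerLawFromTelemetry`

Settles item `stmt-CriticalPhenomena-4498` (support of route `InverseSquareTelemetry`): the glue
(T) → (A) → item 0634. Write `G := criticalTwoPoint 3` (`⟨σ₀σ_x⟩⁺_{β_c}` on `ℤ³`),
`(Δ_{ℤ³}G)(x) := Σ_i (G(x+e_i) + G(x−e_i)) − 6 G(x)` and `V_eff := Δ_{ℤ³}G / G`. Hypothesis (T)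
(inverse-square telemetry) is the Dini-rate inverse-square law `| ‖x‖₂² V_eff(x) − κ | ≤ C‖x‖₂^{−ε}`
for `x ≠ 0`; hypothesis (A) (lattice Agmon–Murata–Pinchover asymptotics) says that every positive
solution `u` of `Δ_{ℤ³}u = V u` on `{‖x‖₂ ≥ R}` with such a `V` and `u → 0` (cofinite) satisfies
`u(x) ‖x‖₂^{α₊} → c > 0`, `α₊ = (1 + √(1+4κ))/2`. The proof instantiates (A) with `u := G`,
`V := V_eff`, `R := 1`: positivity of `G` off the origin and `G → 0` are the tree theorems
`criticalTwoPoint_bounds_holds` (`0 < c‖x‖∞⁻² ≤ G(x) ≤ C‖x‖∞⁻¹`, Duminil-Copin 2019 Thm 4.8) and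
`criticalTwoPoint_tendsto_zero_cofinite`; the equation `Δ_{ℤ³}G = V_eff · G` holds by
`div_mul_cancel₀` wherever `G ≠ 0`; the Dini bound is (T) verbatim; finally `Δ := α₊/2` and
`2 · (α₊/2) = α₊`. Pure logic plus two tree theorems; no named facts (unconditional).

What is NOT here: (T) = item `stmt-CriticalPhenomena-4495` (`InverseSquareLaw`) and
(A) = item `stmt-CriticalPhenomena-4496` (`PositiveSolutionAsymptotics`), the two cruxes that carry
the mathematics; this file only checks that they compose to the pure power law
`IsingEuclidUpgradeR2RotInvPowerLaw` (item 0634) exactly as typed.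
-/

namespace Summit.CriticalPhenomena.Ising3DConformalLimit.Theorems

open Filter Literature.Probability.LatticeModels
open Summit.CriticalPhenomena.Ising3DConformalLimit.Theses.InverseSquareTelemetry

/-- A lattice point of `ℤ³` with Euclidean norm at least `1` is not the origin
(`‖0‖₂ = √0 = 0 < 1`). [folklore] -/
theorem site_three_ne_zero_of_one_le_sqrt {x : Site 3}
    (hx : (1 : ℝ) ≤ Real.sqrt (∑ i, ((x i : ℝ)) ^ 2)) : x ≠ 0 := by
  rintro rfl
  have h0 : Real.sqrt (∑ i, (((0 : Site 3) i : ℝ)) ^ 2) = 0 := by simp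
  rw [h0] at hx
  exact absurd hx (by norm_num)

/-- The critical two-point function of the `ℤ³` Ising model is strictly positive off the origin:
`0 < c‖x‖∞⁻² ≤ ⟨σ₀σ_x⟩⁺_{β_c}` for `x ≠ 0` by the tree theorem `criticalTwoPoint_bounds_holds`
(Simon–Lieb lower bound; Duminil-Copin 2019, Thm 4.8). [folklore] -/
theorem criticalTwoPoint_three_pos_of_ne_zero {x : Site 3} (hx : x ≠ 0) :
    0 < criticalTwoPoint 3 x := by
  obtain ⟨c, _C, hc, hbd⟩ := criticalTwoPoint_bounds_holds (d := 3) le_rfl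
  have hn : 0 < (‖x‖ : ℝ) := norm_pos_iff.mpr hx
  exact lt_of_lt_of_le (mul_pos hc (Real.rpow_pos_of_pos hn _)) (hbd x hx).1

/-- Settles `stmt-CriticalPhenomena-4498` (exact signature of
`Theses.InverseSquareTelemetry.PowerLawFromTelemetry`): inverse-square telemetry (T) and lattice
Agmon–Murata–Pinchover asymptotics (A) give the rotation-invariant pure power law
`⟨σ₀σ_x⟩⁺_{β_c} · ‖x‖₂^{2Δ} → c > 0` (cofinite filter of `ℤ³`) with `2Δ = α₊(κ) = (1+√(1+4κ))/2`.
Proof: apply (A) to `u := criticalTwoPoint 3`, `V := Δ_{ℤ³}G/G`, `R := 1`; positivity from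
`criticalTwoPoint_three_pos_of_ne_zero`, decay from `criticalTwoPoint_tendsto_zero_cofinite`, the
equation by `div_mul_cancel₀`, the Dini bound is (T); take `Δ := α₊/2`. [folklore] -/
theorem powerLawFromTelemetry_proof : PowerLawFromTelemetry := by
  unfold PowerLawFromTelemetry
  intro hT hA
  obtain ⟨κ, ε, C, hκ, hε, hb⟩ := hT
  have hne : ∀ x : Site 3, (1 : ℝ) ≤ Real.sqrt (∑ i, ((x i : ℝ)) ^ 2) → x ≠ 0 :=
    fun x hx => site_three_ne_zero_of_one_le_sqrt hx
  obtain ⟨c, hc, ht⟩ := hA κ ε C hκ hε (criticalTwoPoint 3)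
    (fun x => ((∑ i : Fin 3, (criticalTwoPoint 3 (x + Pi.single i 1)
      + criticalTwoPoint 3 (x - Pi.single i 1))) - 6 * criticalTwoPoint 3 x) /
        criticalTwoPoint 3 x)
    1
    (fun x hx => criticalTwoPoint_three_pos_of_ne_zero (hne x hx))
    (fun x hx => (div_mul_cancel₀ _ (criticalTwoPoint_three_pos_of_ne_zero (hne x hx)).ne').symm)
    (fun x hx => hb x (hne x hx))
    criticalTwoPoint_tendsto_zero_cofinite
  refine ⟨(1 + Real.sqrt (1 + 4 * κ)) / 2 / 2, c, hc, ?_⟩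
  have h2 : 2 * ((1 + Real.sqrt (1 + 4 * κ)) / 2 / 2) = (1 + Real.sqrt (1 + 4 * κ)) / 2 := by
    ring
  rw [h2]
  exact ht

end Summit.CriticalPhenomena.Ising3DConformalLimit.Theorems
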